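import Literature.Probability.RandomPlanarGeometry.HexSAWHexagonSurgery
import HarnessLib

/-!
# Kesten's transfer count (P1) on the hexagonal lattice: `#{ω' ∈ S_{N+2}(ℍ) : J ≥ 1} ≤ Σ_ω I(ω)/max(J(ω) − 24, 1)`

Topic `Literature/Probability/RandomPlanarGeometry` (continues `HexSAWHexagonSurgery.lean`: the hexagon surgery `hexIns`/`hexDel`, the
slot and deletion-site counts `hexSlots` (`I`) / `hexSharp` (`J`), the pair bijection `sum_hexSlotPairs_eq_sum_hexSharpPairs`, and the
bounded bookkeeping `1 ≤ J'`, `J ≤ J' + 24`).  Source: N. Madras, G. Slade, *The Self-Avoiding Walk* (1993), §7.3, proof of Theorem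
7.3.2, eq. (7.3.6) (p. 245): counting the pairs (walk, surgery site) of `S_N` against the pairs (walk, deletion site) of the longer walks;
printed for `ℤ^d` (Theorem 7.3.4(a), Kesten 1963), here on `ℍ` (never written out in print; lane «pcv-sawmu» HEX-RATIO-2, block (P1-ℍ))
— the `ℍ` twin of the tree's `SAW.triKesten_P1'` / `SAW.triKesten_P1` (`SAWTriangularKestenTransfer.lean`, text of a-p5 g4).

## What is here (namespace `Literature.Probability.RandomPlanarGeometry.SAW.HV`; all proved, axioms standard)

* **`hexKesten_P1'`** — `#{ω' ∈ S_{N+2}(ℍ) : 1 ≤ J(ω')} ≤ Σ_{ω ∈ S_N(ℍ)} I(ω)/max(J(ω) − 24, 1)` (shape of hypothesis `hP1`, `c₁ = 24`,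
  of `SAW.kesten_ineq_of_transfer`);
* `hexKesten_P1` — the partition form `c_{N+2}(ℍ) − #{ω' : J(ω') = 0} ≤ Σ_ω I(ω)/max(1, J(ω) − 24)`.
-/

noncomputable section

open Finset
open Literature.Probability.LatticeModels Literature.Probability.Percolation SimpleGraph

namespace Literature.Probability.RandomPlanarGeometry.SAW.HV

/-! ### (P1-ℍ) The single transfer: `#{ω' ∈ S_{N+2}(ℍ) : J ≥ 1} ≤ Σ_ω I(ω)/max(J(ω) − 24, 1)` -/

section TransferP1H

/-- **(P1-ℍ), the first counting on `ℍ`** (Madras–Slade (7.3.6) with inexact bookkeeping), in the shape of hypothesis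
`hP1` (`c₁ = 24`) of the lane's abstract Kesten inequality `SAW.kesten_ineq_of_transfer`: the number of `(N+2)`-step
hexagonal-lattice walks with at least one deletion site equals `Σ_{(ω,s)} 1/J(hexIns_s ω)` over the slot pairs of `S_N(ℍ)`, and
`J(hexIns_s ω) ≥ max(J(ω) − 24, 1)` — the `ℍ` twin of the tree's `SAW.hexKesten_P1'`.
[cite: MadrasSlade1993, Theorem 7.3.2 (proof), (7.3.6)] -/
theorem hexKesten_P1' (N : ℕ) :
    (#((sawFin hvOrigin (N + 2)).filter fun ω' => 1 ≤ #(hexSharp ω')) : ℝ) ≤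
      ∑ ω ∈ sawFin hvOrigin N, (#(hexSlots ω) : ℝ) / max ((#(hexSharp ω) : ℝ) - 24) 1 := by
  -- the left side is `Σ_{ω'} J(ω') · (1/J(ω'))`, a sum over the deletion-site pairs of `S_{N+2}(ℍ)`
  have hJ : (#((sawFin hvOrigin (N + 2)).filter fun ω' => 1 ≤ #(hexSharp ω')) : ℝ) =
      ∑ ω ∈ sawFin hvOrigin (N + 2), (#(hexSharp ω) : ℝ) * (1 / (#(hexSharp ω) : ℝ)) := by
    rw [card_eq_sum_ones, Nat.cast_sum, sum_filter]
    refine sum_congr rfl fun ω _ => ?_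
    by_cases h : 1 ≤ #(hexSharp ω)
    · rw [if_pos h, Nat.cast_one, mul_one_div_cancel]
      exact_mod_cast (show #(hexSharp ω) ≠ 0 by omega)
    · rw [if_neg h, show #(hexSharp ω) = 0 by omega]
      simp
  rw [hJ, ← sum_hexSharpPairs (N + 2) (fun ω => 1 / (#(hexSharp ω) : ℝ)),
    ← sum_hexSlotPairs_eq_sum_hexSharpPairs N (fun p => 1 / (#(hexSharp (hexIns p.2.1 p.2.2.1 p.2.2.2.1 p.2.2.2.2 p.1)) : ℝ))
      (fun q => 1 / (#(hexSharp q.1) : ℝ)) (fun p _ => rfl)]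
  -- termwise `1/J(ins) ≤ 1/max(J − 24, 1)`, then re-sum over walks
  have hR : ∑ ω ∈ sawFin hvOrigin N, (#(hexSlots ω) : ℝ) / max ((#(hexSharp ω) : ℝ) - 24) 1 =
      ∑ p ∈ hexSlotPairs N, 1 / max ((#(hexSharp p.1) : ℝ) - 24) 1 := by
    rw [sum_hexSlotPairs N (fun ω => 1 / max ((#(hexSharp ω) : ℝ) - 24) 1)]
    refine sum_congr rfl fun ω _ => ?_
    rw [mul_one_div]
  rw [hR]
  refine sum_le_sum fun p hp => ?_
  obtain ⟨ω, m, x, y, z⟩ := p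
  rw [hexSlotPairs, mem_sigma] at hp
  dsimp only at hp ⊢
  obtain ⟨hω, hs⟩ := hp
  have h1 : (1 : ℝ) ≤ #(hexSharp (hexIns m x y z ω)) := by exact_mod_cast one_le_card_hexSharp_hexIns hω hs
  have h2 : (#(hexSharp ω) : ℝ) - 24 ≤ #(hexSharp (hexIns m x y z ω)) := by
    have := card_hexSharp_le_hexIns hω hs
    have h' : (#(hexSharp ω) : ℝ) ≤ #(hexSharp (hexIns m x y z ω)) + 24 := by exact_mod_cast this
    linarith
  exact one_div_le_one_div_of_le (lt_of_lt_of_le one_pos (le_max_right _ _)) (max_le h2 h1)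

/-- **(P1-ℍ)** in partition form: `c_{N+2}(ℍ) − #{ω' ∈ S_{N+2}(ℍ) : J(ω') = 0} ≤ Σ_{ω ∈ S_N(ℍ)} I(ω)/max(1, J(ω) − 24)`.
[cite: MadrasSlade1993, Theorem 7.3.2 (proof), (7.3.6)] -/
theorem hexKesten_P1 (N : ℕ) :
    (hexSawCount (N + 2) : ℝ) - #((sawFin hvOrigin (N + 2)).filter fun ω => #(hexSharp ω) = 0) ≤
      ∑ ω ∈ sawFin hvOrigin N, (#(hexSlots ω) : ℝ) / max 1 ((#(hexSharp ω) : ℝ) - 24) := by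
  have hsplit := card_filter_add_card_filter_not (s := sawFin hvOrigin (N + 2)) (p := fun ω => #(hexSharp ω) = 0)
  rw [← hexSawCount_eq_card] at hsplit
  have hL : (hexSawCount (N + 2) : ℝ) - #((sawFin hvOrigin (N + 2)).filter fun ω => #(hexSharp ω) = 0) =
      #((sawFin hvOrigin (N + 2)).filter fun ω' => 1 ≤ #(hexSharp ω')) := by
    have h : (hexSawCount (N + 2) : ℝ) = #((sawFin hvOrigin (N + 2)).filter fun ω => #(hexSharp ω) = 0) +
        #((sawFin hvOrigin (N + 2)).filter fun ω => ¬#(hexSharp ω) = 0) := by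
      exact_mod_cast hsplit.symm
    have e : ((sawFin hvOrigin (N + 2)).filter fun ω => ¬#(hexSharp ω) = 0) =
        ((sawFin hvOrigin (N + 2)).filter fun ω' => 1 ≤ #(hexSharp ω')) :=
      filter_congr fun ω _ => by omega
    rw [← e]
    linarith
  rw [hL]
  simp only [max_comm (1 : ℝ)]
  exact hexKesten_P1' N

end TransferP1H

end Literature.Probability.RandomPlanarGeometry.SAW.HV
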